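import Summits.AtomisticToContinuum.Crystallization.Theorems.PricedLinkCensusTruncatedCensusGapGapOfPeriodicPricing
import Summits.AtomisticToContinuum.Crystallization.Theorems.PricedLinkCensusTruncatedCensusGapChargeLocality
import Summits.AtomisticToContinuum.Crystallization.Theorems.PricedLinkCensusTruncatedCensusGapSeparatedDenseReduction

/-!
# Periodic pricing for `1/4`-separated periodic configurations implies `TruncatedCensusGap`

Stub `truncatedCensusGap_of_separatedPeriodicPricing` (SEPARATED PERIODIC PRICING ⇒ CRUX) of the
line `sharp-m-potential-compactness` for the crux `PricedLinkCensus.TruncatedCensusGap`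
(item stmt-AtomisticToContinuum-14230).  The final statement is the registered signature VERBATIM.

With `V_χ r = min 1 (max 0 (4 - 2r)) · V_LJ r` (range `2`) and `e_χ* = ⨅_Q e_χ(Q)` over periodic
configurations, the crux is `∃ κ > 0, ∀ N (y : Fin N → ℝ³) injective,
N·e_χ* + κ·#(charged sites of y) ≤ E_χ(y)`.  The hypothesis is the periodic pricing
`κ · motifCharged (1/100) Q ≤ #F · (e_χ(Q) − e_χ*)` demanded ONLY of the periodic configurations
`Q` whose point set is uniformly `1/4`-separated.

Proof.  By the landed compact-strata reduction
(`truncatedCensusGap_of_separatedDense_of_locality`, fed with the landed charge locality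
`isChargeFree_sub_iff`) it suffices to price the finite injective configurations `y` that are
`1/4`-SEPARATED and `2`-DENSE.  For such a `y` with `N ≥ 1` points (so `N ≥ 2` by density) take
the far periodisation `y + (8D+8)ℤ³` (`ChargedEnergyGapNegative.periodiseFar`): its motif is
`{yᵢ}` (`N` points), its charged motif sites are exactly the charged sites of `y`
(`motifCharged_periodiseFar`), its energy per particle is EXACTLY `E_χ(y)/N` since `V_χ` vanishes
on `[2, ∞)` and distinct copies are more than `8` apart
(`energyPerParticle_periodiseFar_eq_div`), and — the only new point — its point set is
`1/4`-separated: two points `yᵢ + g`, `yⱼ + g'` with the same period `g = g'` are `dist yᵢ yⱼ ≥ 1/4`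
apart, and with different periods at least `‖g − g'‖ − ‖yⱼ − yᵢ‖ ≥ 8` apart
(`norm_sub_add_le_norm_of_mem_lattice_periodiseFar`).  The hypothesis applied to it is the claim.
-/

noncomputable section

namespace Summit.AtomisticToContinuum.Crystallization.Theorems.PricedLinkCensusTruncatedCensusGap

open Literature.MathematicalPhysics.StatisticalMechanics Literature.Geometry.DiscreteGeometry
open Summit.AtomisticToContinuum.Crystallization.Theorems.ChargedEnergyGapNegative

/-- **The far periodisation of a `1/4`-separated configuration is `1/4`-separated**: two distinct
points `yᵢ + g`, `yⱼ + g'` of `y + (8D+8)ℤ³` are `dist yᵢ yⱼ ≥ 1/4` apart if `g = g'`, and at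
least `‖g − g'‖ − ‖yⱼ − yᵢ‖ ≥ 8` apart otherwise. [folklore] -/
theorem separated_points_periodiseFar {N : ℕ} {y : Fin N → E3} (hN : 0 < N)
    (hsep : ∀ j k : Fin N, j ≠ k → 1 / 4 ≤ dist (y j) (y k)) :
    ∀ p ∈ (periodiseFar y hN).points, ∀ q ∈ (periodiseFar y hN).points, p ≠ q →
      1 / 4 ≤ dist p q := by
  rintro p ⟨a, ha, g, hg, rfl⟩ q ⟨b, hb, g', hg', rfl⟩ hne
  rw [motif_periodiseFar] at ha hb
  obtain ⟨i, -, rfl⟩ := Finset.mem_image.1 ha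
  obtain ⟨j, -, rfl⟩ := Finset.mem_image.1 hb
  by_cases hgg : g = g'
  · subst hgg
    have hij : i ≠ j := by
      rintro rfl
      exact hne rfl
    rw [dist_add_right]
    exact hsep i j hij
  · have hmem : g - g' ∈ (periodiseFar y hN).lattice :=
      (periodiseFar y hN).lattice.sub_mem hg hg'
    have h8 := norm_sub_add_le_norm_of_mem_lattice_periodiseFar y hN hmem (sub_ne_zero.2 hgg) j i
    have h1 : ‖g - g'‖ - ‖y j - y i‖ ≤ dist (y i + g) (y j + g') := by
      rw [dist_eq_norm, show y i + g - (y j + g') = (g - g') - (y j - y i) by abel]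
      exact norm_sub_norm_le _ _
    linarith [norm_nonneg (y j - y i)]

/-- **Periodic pricing for `1/4`-separated periodic configurations implies `TruncatedCensusGap`.**
If every periodic configuration of `ℝ³` with a uniformly `1/4`-separated point set pays `κ > 0`
per charged motif site (tolerance `1/100`) above `e_χ*`, then the crux holds: the far
periodisation of a `1/4`-separated, `2`-dense finite injective configuration is `1/4`-separated,
has the charged sites of `y` as its charged motif sites and energy per particle `E_χ(y)/N`, so
such configurations are priced, and the compact-strata reduction
(`truncatedCensusGap_of_separatedDense_of_locality` with `isChargeFree_sub_iff`) does the rest.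
[folklore] -/
theorem truncatedCensusGap_of_separatedPeriodicPricing : (∃ κ : ℝ, 0 < κ ∧ ∀ Q : PeriodicConfiguration 3, (∀ p ∈ Q.points, ∀ q ∈ Q.points, p ≠ q → 1 / 4 ≤ dist p q) → κ * (Summit.AtomisticToContinuum.Crystallization.Theorems.ChargedEnergyGapNegative.motifCharged (1 / 100) Q : ℝ) ≤ (Q.motif.card : ℝ) * (Q.energyPerParticle (fun r => min 1 (max 0 (4 - 2 * r)) * lennardJones r) - ⨅ Q' : PeriodicConfiguration 3, Q'.energyPerParticle (fun r => min 1 (max 0 (4 - 2 * r)) * lennardJones r))) → Summit.AtomisticToContinuum.Crystallization.Theses.PricedLinkCensus.TruncatedCensusGap := by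
  rintro ⟨κ, hκ, h⟩
  refine truncatedCensusGap_of_separatedDense_of_locality isChargeFree_sub_iff ⟨κ, hκ, ?_⟩
  intro N y hy hsep hdense
  show (N : ℝ) * _ + κ * (charged (1 / 100) y : ℝ) ≤ _
  rcases Nat.eq_zero_or_pos N with rfl | hN0
  · rw [charged_zero, interactionEnergy_of_subsingleton]
    simp
  -- `N ≥ 1`, hence `N ≥ 2` by density: the far periodisation
  have hN2 : ∀ i : Fin N, ∃ j, j ≠ i := fun i => by
    obtain ⟨k, hk, -⟩ := hdense i
    exact ⟨k, hk⟩
  have hp := h (periodiseFar y hN0) (separated_points_periodiseFar hN0 hsep)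
  rw [motifCharged_periodiseFar hy hN0 (by norm_num) hN2] at hp
  have hcard : (((periodiseFar y hN0).motif.card : ℕ) : ℝ) = N := by
    rw [motif_periodiseFar, Finset.card_image_of_injective _ hy, Finset.card_univ,
      Fintype.card_fin]
  have he : (periodiseFar y hN0).energyPerParticle
      (fun r => min 1 (max 0 (4 - 2 * r)) * lennardJones r) =
      interactionEnergy (fun r => min 1 (max 0 (4 - 2 * r)) * lennardJones r) y / N :=
    energyPerParticle_periodiseFar_eq_div truncLJ_eq_zero_of_two_le (by norm_num) hy hN0
  rw [hcard, he, mul_sub] at hp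
  have hNr : (0 : ℝ) < N := by exact_mod_cast hN0
  have hmul : (N : ℝ) *
      (interactionEnergy (fun r => min 1 (max 0 (4 - 2 * r)) * lennardJones r) y / N) =
      interactionEnergy (fun r => min 1 (max 0 (4 - 2 * r)) * lennardJones r) y := by
    field_simp
  linarith

end Summit.AtomisticToContinuum.Crystallization.Theorems.PricedLinkCensusTruncatedCensusGap

end
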